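import Summits.Langlands.Langlands.Theses.PicardMuOrdinary

/-!
# `MuOrdinaryFamilyRT`: audit of the conclusion's congruence encoding (negative-side lemmas)

The conclusion of the crux `Summit.Langlands.Langlands.Theses.PicardMuOrdinary.MuOrdinaryFamilyRT`
(item stmt-Langlands-13757) expresses "`t ≡ 0 (mod 3^k ℤ̄_𝔐)`" for `t ∈ ℤ̄ = integralClosure ℤ ℂ`
and a maximal `𝔐 ∋ 3` as `∃ u, u ∉ 𝔐 ∧ u * t ∈ Ideal.span {3 ^ k}` (literally: `∃ (t u : ℤ̄), … ∧
u ∉ 𝔐 ∧ u * t ∈ Ideal.span {(3 : ℤ̄) ^ k}`).  Findings of the standing disprover, all sorry-free: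

* the encoding is a genuine congruence (`cong_add`, `cong_mul_left`, `cong_mono`, `cong_of_dvd`)
  whose levels are STRICTLY nested — `3 ^ k` lies in level `k` but not in level `k + 1`
  (`cong_self_three_pow`, `not_cong_succ_three_pow`), so `∀ k` is an infinite conjunction of ever
  stronger conditions and the statement is not degenerate;
* TRAP (a): the tempting restatement `t ∈ 𝔐 ^ k` IS degenerate — every prime of `ℤ̄` is
  idempotent (`sq_eq_self_of_isPrime`, `pow_eq_self_of_isPrime`; every algebraic integer has an
  algebraic-integer square root, `exists_sq_eq`), so `t ∈ 𝔐 ^ k ↔ t ∈ 𝔐` (`mem_pow_iff_mem`);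
* TRAP (b): level `k = 1` is congruence modulo `3 = λ² · unit`, strictly finer than the residual
  congruence modulo `λ = 1 − ω` supplied by the crux's hypothesis together with the route item
  `BranchPointCongruence`: for any `ζ ∈ ℤ̄` with `ζ² + ζ + 1 = 0` (`exists_zeta`) one has
  `1 − ζ ∈ 𝔐` (`one_sub_zeta_mem`) but `1 − ζ` is NOT `≡ 0 (mod 3 ℤ̄_𝔐)`
  (`not_cong_one_one_sub_zeta`).  Hence the residual representation `P` of the hypothesis is in
  general not an admissible first approximant `P₁` (numerically: `3 ∣ a_𝔭(f) − (#roots − 1)` for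
  only about a third of the primes, kit job j008154).
-/

set_option linter.dupNamespace false -- project-wide option (lakefile weak.linter.dupNamespace); `Summit.Langlands.Langlands` is the mandated namespace

namespace Summit.Langlands.Langlands.Theorems.MuOrdinaryFamilyRT.Negative

/-- `3 ≠ 0` in `ℤ̄` (read off in `ℂ`). [folklore] -/
theorem three_ne_zero_integralClosure : (3 : integralClosure ℤ ℂ) ≠ 0 := by
  intro h
  have := congrArg (fun x : integralClosure ℤ ℂ => (x : ℂ)) h
  norm_num at this

/-- Global divisibility by `3 ^ k` implies the congruence at `𝔐`. [folklore] -/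
theorem cong_of_dvd {𝔐 : Ideal (integralClosure ℤ ℂ)} (hne : 𝔐 ≠ ⊤) {k : ℕ}
    {t : integralClosure ℤ ℂ} (h : (3 : integralClosure ℤ ℂ) ^ k ∣ t) :
    ∃ u, u ∉ 𝔐 ∧ u * t ∈ Ideal.span {(3 : integralClosure ℤ ℂ) ^ k} :=
  ⟨1, fun h1 => hne ((Ideal.eq_top_iff_one 𝔐).mpr h1), by
    simpa [Ideal.mem_span_singleton] using h⟩

/-- The levels are nested. [folklore] -/
theorem cong_mono {𝔐 : Ideal (integralClosure ℤ ℂ)} {j k : ℕ} (hjk : j ≤ k)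
    {t : integralClosure ℤ ℂ} (h : ∃ u, u ∉ 𝔐 ∧ u * t ∈ Ideal.span {(3 : integralClosure ℤ ℂ) ^ k}) :
    ∃ u, u ∉ 𝔐 ∧ u * t ∈ Ideal.span {(3 : integralClosure ℤ ℂ) ^ j} := by
  obtain ⟨u, hu, hut⟩ := h
  exact ⟨u, hu, Ideal.span_singleton_le_span_singleton.mpr (pow_dvd_pow 3 hjk) hut⟩

/-- Additivity (for `𝔐` prime): the relation is a congruence. [folklore] -/
theorem cong_add {𝔐 : Ideal (integralClosure ℤ ℂ)} (h𝔐 : 𝔐.IsPrime) {k : ℕ}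
    {s t : integralClosure ℤ ℂ}
    (hs : ∃ u, u ∉ 𝔐 ∧ u * s ∈ Ideal.span {(3 : integralClosure ℤ ℂ) ^ k})
    (ht : ∃ u, u ∉ 𝔐 ∧ u * t ∈ Ideal.span {(3 : integralClosure ℤ ℂ) ^ k}) :
    ∃ u, u ∉ 𝔐 ∧ u * (s + t) ∈ Ideal.span {(3 : integralClosure ℤ ℂ) ^ k} := by
  obtain ⟨u, hu, hus⟩ := hs
  obtain ⟨w, hw, hwt⟩ := ht
  refine ⟨u * w, fun h => (h𝔐.mem_or_mem h).elim hu hw, ?_⟩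
  have : u * w * (s + t) = w * (u * s) + u * (w * t) := by ring
  rw [this]
  exact Ideal.add_mem _ (Ideal.mul_mem_left _ _ hus) (Ideal.mul_mem_left _ _ hwt)

/-- Stability under multiplication. [folklore] -/
theorem cong_mul_left {𝔐 : Ideal (integralClosure ℤ ℂ)} {k : ℕ} {t : integralClosure ℤ ℂ}
    (a : integralClosure ℤ ℂ)
    (ht : ∃ u, u ∉ 𝔐 ∧ u * t ∈ Ideal.span {(3 : integralClosure ℤ ℂ) ^ k}) :
    ∃ u, u ∉ 𝔐 ∧ u * (a * t) ∈ Ideal.span {(3 : integralClosure ℤ ℂ) ^ k} := by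
  obtain ⟨u, hu, hut⟩ := ht
  refine ⟨u, hu, ?_⟩
  have : u * (a * t) = a * (u * t) := by ring
  rw [this]
  exact Ideal.mul_mem_left _ _ hut

/-- `3 ^ k` is at level `k`. [folklore] -/
theorem cong_self_three_pow {𝔐 : Ideal (integralClosure ℤ ℂ)} (hne : 𝔐 ≠ ⊤) (k : ℕ) :
    ∃ u, u ∉ 𝔐 ∧ u * (3 : integralClosure ℤ ℂ) ^ k ∈ Ideal.span {(3 : integralClosure ℤ ℂ) ^ k} :=
  cong_of_dvd hne dvd_rfl

/-- NON-DEGENERACY: `3 ^ k` is NOT at level `k + 1` — the levels are strictly nested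
(`v_𝔐(3) = 1`). [folklore] -/
theorem not_cong_succ_three_pow {𝔐 : Ideal (integralClosure ℤ ℂ)}
    (h3 : (3 : integralClosure ℤ ℂ) ∈ 𝔐) (k : ℕ) :
    ¬ ∃ u, u ∉ 𝔐 ∧ u * (3 : integralClosure ℤ ℂ) ^ k ∈
        Ideal.span {(3 : integralClosure ℤ ℂ) ^ (k + 1)} := by
  rintro ⟨u, hu, hmem⟩
  obtain ⟨w, hw⟩ := Ideal.mem_span_singleton.mp hmem
  have : u = 3 * w := by
    apply mul_right_cancel₀ (pow_ne_zero k three_ne_zero_integralClosure)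
    rw [hw]; ring
  exact hu (this ▸ Ideal.mul_mem_right w 𝔐 h3)

/-- Every algebraic integer has an algebraic-integer square root. [folklore] -/
theorem exists_sq_eq (x : integralClosure ℤ ℂ) : ∃ y : integralClosure ℤ ℂ, y ^ 2 = x := by
  obtain ⟨z, hz⟩ := IsAlgClosed.exists_pow_nat_eq (x : ℂ) (n := 2) (by norm_num)
  have hzint : IsIntegral ℤ z := by
    refine IsIntegral.of_pow (by norm_num : 0 < 2) ?_
    rw [hz]
    exact x.2
  refine ⟨⟨z, hzint⟩, ?_⟩
  ext
  simp [hz]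

/-- TRAP (a): prime ideals of `ℤ̄` are idempotent. [folklore] -/
theorem sq_eq_self_of_isPrime {𝔐 : Ideal (integralClosure ℤ ℂ)} (h𝔐 : 𝔐.IsPrime) :
    𝔐 ^ 2 = 𝔐 := by
  refine le_antisymm (Ideal.pow_le_self two_ne_zero) fun x hx => ?_
  obtain ⟨y, rfl⟩ := exists_sq_eq x
  have hy : y ∈ 𝔐 := h𝔐.mem_of_pow_mem 2 hx
  rw [pow_two, pow_two]
  exact Ideal.mul_mem_mul hy hy

/-- TRAP (a), all levels: `𝔐 ^ k = 𝔐` for `k ≥ 1`. [folklore] -/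
theorem pow_eq_self_of_isPrime {𝔐 : Ideal (integralClosure ℤ ℂ)} (h𝔐 : 𝔐.IsPrime) {k : ℕ}
    (hk : 1 ≤ k) : 𝔐 ^ k = 𝔐 := by
  induction k with
  | zero => omega
  | succ n ih =>
    rcases Nat.eq_zero_or_pos n with rfl | hn
    · simp
    · rw [pow_succ, ih hn, ← pow_two, sq_eq_self_of_isPrime h𝔐]

/-- TRAP (a), consequence: `t ∈ 𝔐 ^ k ↔ t ∈ 𝔐` for `k ≥ 1` — ideal powers do NOT encode a 3-adic
limit in `ℤ̄`. [folklore] -/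
theorem mem_pow_iff_mem {𝔐 : Ideal (integralClosure ℤ ℂ)} (h𝔐 : 𝔐.IsPrime) {k : ℕ} (hk : 1 ≤ k)
    (t : integralClosure ℤ ℂ) : t ∈ 𝔐 ^ k ↔ t ∈ 𝔐 := by
  rw [pow_eq_self_of_isPrime h𝔐 hk]

/-- A primitive cube root of unity exists in `ℤ̄`. [folklore] -/
theorem exists_zeta : ∃ ζ : integralClosure ℤ ℂ, ζ ^ 2 + ζ + 1 = 0 := by
  have hprim : IsPrimitiveRoot (Complex.exp (2 * Real.pi * Complex.I / 3)) 3 :=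
    Complex.isPrimitiveRoot_exp 3 (by norm_num)
  set z := Complex.exp (2 * Real.pi * Complex.I / 3) with hz
  have h3 : z ^ 3 = 1 := hprim.pow_eq_one
  have hsum : z ^ 2 + z + 1 = 0 := by
    have := hprim.geom_sum_eq_zero (by norm_num : 1 < 3)
    simp only [Finset.sum_range_succ, Finset.sum_range_zero, pow_zero, pow_one, zero_add] at this
    linear_combination this
  have hzint : IsIntegral ℤ z := by
    refine IsIntegral.of_pow (by norm_num : 0 < 3) ?_
    rw [h3]
    exact isIntegral_one
  refine ⟨⟨z, hzint⟩, ?_⟩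
  ext
  simp [hsum]

/-- `(1 − ζ)² = −3ζ`, so `1 − ζ ∈ 𝔐` for every prime `𝔐 ∋ 3`. [folklore] -/
theorem one_sub_zeta_mem {𝔐 : Ideal (integralClosure ℤ ℂ)} (h𝔐 : 𝔐.IsPrime)
    (h3 : (3 : integralClosure ℤ ℂ) ∈ 𝔐) {ζ : integralClosure ℤ ℂ} (hζ : ζ ^ 2 + ζ + 1 = 0) :
    1 - ζ ∈ 𝔐 := by
  apply h𝔐.mem_of_pow_mem 2
  have : (1 - ζ) ^ 2 = 3 * (-ζ) := by linear_combination hζ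
  rw [this]
  exact Ideal.mul_mem_right _ 𝔐 h3

/-- A cube root of unity lies in no proper ideal. [folklore] -/
theorem zeta_not_mem {𝔐 : Ideal (integralClosure ℤ ℂ)} (h𝔐 : 𝔐.IsPrime)
    {ζ : integralClosure ℤ ℂ} (hζ : ζ ^ 2 + ζ + 1 = 0) : ζ ∉ 𝔐 := by
  intro h
  have h1 : ζ ^ 3 = 1 := by linear_combination (ζ - 1) * hζ
  have : (1 : integralClosure ℤ ℂ) ∈ 𝔐 := by
    rw [← h1, pow_succ, pow_two]
    exact Ideal.mul_mem_left _ _ h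
  exact h𝔐.ne_top ((Ideal.eq_top_iff_one 𝔐).mpr this)

/-- TRAP (b): `1 − ζ ∈ 𝔐` yet `1 − ζ ≢ 0 (mod 3 ℤ̄_𝔐)` — level `k = 1` of the crux's conclusion is
strictly finer than the residual congruence modulo `λ = 1 − ω`. [folklore] -/
theorem not_cong_one_one_sub_zeta {𝔐 : Ideal (integralClosure ℤ ℂ)} (h𝔐 : 𝔐.IsPrime)
    (h3 : (3 : integralClosure ℤ ℂ) ∈ 𝔐) {ζ : integralClosure ℤ ℂ} (hζ : ζ ^ 2 + ζ + 1 = 0) :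
    ¬ ∃ u, u ∉ 𝔐 ∧ u * (1 - ζ) ∈ Ideal.span {(3 : integralClosure ℤ ℂ) ^ 1} := by
  rintro ⟨u, hu, hmem⟩
  obtain ⟨w, hw⟩ := Ideal.mem_span_singleton.mp hmem
  have hsq : (1 - ζ) ^ 2 = 3 * (-ζ) := by linear_combination hζ
  have key : (3 : integralClosure ℤ ℂ) * (u * -ζ) = 3 * (w * (1 - ζ)) := by
    have h2 : u * (1 - ζ) ^ 2 = 3 ^ 1 * w * (1 - ζ) := by
      rw [pow_two, ← mul_assoc, hw]
    rw [hsq] at h2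
    linear_combination h2
  have key' : u * -ζ = w * (1 - ζ) := mul_left_cancel₀ three_ne_zero_integralClosure key
  have hmem' : u * -ζ ∈ 𝔐 := by
    rw [key']
    exact Ideal.mul_mem_left _ _ (one_sub_zeta_mem h𝔐 h3 hζ)
  rcases h𝔐.mem_or_mem hmem' with h | h
  · exact hu h
  · exact zeta_not_mem h𝔐 hζ (by simpa using 𝔐.neg_mem_iff.mp h)

end Summit.Langlands.Langlands.Theorems.MuOrdinaryFamilyRT.Negative
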